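import Mathlib
import Literature.Analysis.ValidatedNumerics.IntervalLogArctan
import HarnessLib

/-!
# ζ(5) search — BARRIER: kernel ENCLOSURES of the closed-form flow bound `B_F(t) = x_top(t) − Σ ε_m x_m log x_m`
# at rational directions and over rational direction BOXES (Lemma F numerics)

HONEST FRAMING (cell `pub-zeta5`): systematic search; no irrationality claim unless kernel-certified. Kernel ARITHMETIC
(outward-rounded fixed-point enclosures of an explicit elementary function of the direction) on top of cert-2 g32/g33's
certified separable majorants F7 / F6 of BZ's saving step function (`torusN_le_F7` / `torusN_le_F6`) and P2 g24's
LEMMA F (`ConeGammaLemmaF`, `phi30_le_of_sepBound`): those give `Φ(a)/s₀ ≤ B_F(t) = x_top(t) − Σ_m ε_m x_m(t) log x_m(t)`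
(t = s(a)/s₀, x_m = m·t the feature values) — a MODEL-side object under BZ (28)+(30) ((28) observed, not proved)
exactly as `Φ = phi30` is. This file bounds the real-valued EXPRESSION `bForm F top t = x_top(t) − E_F(t)` only;
the connection to `phi30` is made in the certificate file that imports P2 g24's theorems. Nothing here is about any
`γ` of record, the cone's sup, C2 (OPEN), S-E (CONJECTURED), (TD_A) or `ζ(5)`; records in print UNMOVED. Theory
seat cert-2 g34 (item «LEMMA F NUMERICS IN THE KERNEL — POINTS AND BOXES», INBOX plan 2026-08-27).

* Real side: `featVal c t = Σ_{i<8} c_i t_i`, `entF F t = Σ_{(ε,c)∈F} ε·x_c(t)·log x_c(t)`, `bForm F top t`.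
* Checker (computable; the tree's `NumericsMP.MI` fixed-point intervals at scale `2^60`, `MI.logNat2`): on a box
  `lo_i ≤ D·t_i ≤ hi_i` every feature has the exact integer range `[minNum, maxNum]/D`; the centre value is enclosed
  from logarithms of naturals; the MEAN-VALUE slack is `Σ_i r_i·M_i` with `M_i ≥ sup_box |∂_i B|`,
  `∂_i B = c_top,i − Σ_m ε_m c_{m,i}(log x_m + 1)`, `log x_m ∈ [log minNum − log D, log maxNum − log D]`
  (`featStep`, `featEnc`, `boxSummary`, `boxCheck`, `pointLowerCheck`).
* Soundness part 1 here (feature ranges on a box, the centre, segments, the logarithm and centre-term enclosures);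
  the recursion invariant `featEnc_sound` and the final theorems `bForm_le_of_boxCheck` / `le_bForm_of_pointCheck`
  are the sequel `ConeGammaLemmaFBoxSound`; feature tables and certificates are `ConeGammaLemmaFBoxCert`.
-/

open Finset Set
open Literature.Analysis.ValidatedNumerics.NumericsMP

namespace Summit.KontsevichZagierPeriods.Zeta5Search.Barrier.ConeGamma

namespace LemmaFBox

/-! ### Real side -/

/-- Coefficient `i` of an integer coefficient list (`0` beyond its length). -/
def coef (c : List ℤ) (i : ℕ) : ℤ := c.getD i 0

/-- The feature value `x_c(t) = Σ_{i<8} c_i t_i`. -/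
noncomputable def featVal (c : List ℤ) (t : Fin 8 → ℝ) : ℝ := ∑ i : Fin 8, (coef c i : ℝ) * t i

/-- The entropy form `E_F(t) = Σ_{(ε,c) ∈ F} ε · x_c(t) · log x_c(t)` of a feature table `F`. -/
noncomputable def entF : List (ℤ × List ℤ) → (Fin 8 → ℝ) → ℝ
  | [], _ => 0
  | f :: F, t => (f.1 : ℝ) * (featVal f.2 t * Real.log (featVal f.2 t)) + entF F t

/-- The closed-form flow bound `B_F(t) = x_top(t) − E_F(t)`. -/
noncomputable def bForm (F : List (ℤ × List ℤ)) (top : List ℤ) (t : Fin 8 → ℝ) : ℝ := featVal top t - entF F t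

/-- `x_c` is additive. -/
theorem featVal_add (c : List ℤ) (t u : Fin 8 → ℝ) : featVal c (t + u) = featVal c t + featVal c u := by
  simp [featVal, mul_add, Finset.sum_add_distrib]

/-- `x_c` is homogeneous. -/
theorem featVal_smul (c : List ℤ) (r : ℝ) (t : Fin 8 → ℝ) : featVal c (r • t) = r * featVal c t := by
  simp [featVal, Finset.mul_sum, mul_left_comm]

/-- `x_c` of a difference. -/
theorem featVal_sub (c : List ℤ) (t u : Fin 8 → ℝ) : featVal c (t - u) = featVal c t - featVal c u := by
  simp [featVal, mul_sub, Finset.sum_sub_distrib]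

/-! ### Computable side -/

/-- Fixed-point scale `2^60`. -/
def SC : ℕ := 2 ^ 60

/-- Series length for the logarithms. -/
def KT : ℕ := 62

/-- `Σ_{i<8} f i` written out (kernel-friendly). -/
def sum8 (f : ℕ → ℤ) : ℤ := f 0 + f 1 + f 2 + f 3 + f 4 + f 5 + f 6 + f 7

/-- Exact minimum of `D·x_c` over the box `lo_i ≤ D t_i ≤ hi_i`. -/
def minNum (c : List ℤ) (lo hi : List ℕ) : ℤ :=
  sum8 fun i => if 0 ≤ coef c i then coef c i * (lo.getD i 0 : ℕ) else coef c i * (hi.getD i 0 : ℕ)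

/-- Exact maximum of `D·x_c` over the box. -/
def maxNum (c : List ℤ) (lo hi : List ℕ) : ℤ :=
  sum8 fun i => if 0 ≤ coef c i then coef c i * (hi.getD i 0 : ℕ) else coef c i * (lo.getD i 0 : ℕ)

/-- `log n` at scale `SC` (the tree's `MI.logNat2`). -/
def lnNat (n : ℕ) : Option MI := MI.logNat2 SC KT n

/-- Accumulator: `ec` encloses the entropy form at the box centre; `g` (8 entries) encloses, for every point of the
box, `Σ_m (−ε_m c_{m,i})(log x_m + 1)` over the active features. -/
structure Acc where
  /-- centre enclosure -/
  ec : MI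
  /-- gradient enclosures -/
  g : List MI

/-- One feature. `A = B = 0`: the feature vanishes on the box (skipped); `A ≤ 0` otherwise: failure. -/
def featStep (D : ℕ) (lo hi : List ℕ) (LD L2D : MI) (acc : Acc) (f : ℤ × List ℤ) : Option Acc :=
  let A := minNum f.2 lo hi
  let B := maxNum f.2 lo hi
  if A = 0 ∧ B = 0 then some acc
  else if A ≤ 0 then none
  else
    match lnNat A.toNat, lnNat B.toNat, lnNat (A + B).toNat with
    | some LA, some LB, some LX =>
      let Lm1 : MI := ((⟨LA.lo, LB.hi⟩ : MI).sub LD).add (MI.ofInt SC 1)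
      let term : MI := ((LX.sub L2D).mulInt (f.1 * (A + B))).divNat (2 * D)
      some ⟨acc.ec.add term,
        (List.range 8).map fun i => (acc.g.getD i ⟨0, 0⟩).add (Lm1.mulInt (-(f.1 * coef f.2 i)))⟩
    | _, _, _ => none

/-- The whole table (structural recursion mirroring `entF`). -/
def featEnc (D : ℕ) (lo hi : List ℕ) (LD L2D : MI) : List (ℤ × List ℤ) → Option Acc
  | [] => some ⟨⟨0, 0⟩, (List.range 8).map fun _ => (⟨0, 0⟩ : MI)⟩
  | f :: F =>
    match featEnc D lo hi LD L2D F with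
    | none => none
    | some acc => featStep D lo hi LD L2D acc f

/-- The box summary: the enclosure `bc` of `B(t_c)` at the centre and the scaled mean-value slack `R`
(`sup_box B ≤ (bc.hi + R/(2D))/SC`). -/
def boxSummary (F : List (ℤ × List ℤ)) (top : List ℤ) (D : ℕ) (lo hi : List ℕ) : Option (MI × ℤ) :=
  match lnNat D, lnNat (2 * D) with
  | some LD, some L2D =>
    match featEnc D lo hi LD L2D F with
    | none => none
    | some acc =>
      let bc : MI := (MI.ofFrac SC (minNum top lo hi + maxNum top lo hi) (2 * D)).sub acc.ec
      let R : ℤ := sum8 fun i =>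
        let P : MI := (acc.g.getD i ⟨0, 0⟩).add (MI.ofInt SC (coef top i))
        ((hi.getD i 0 : ℕ) - (lo.getD i 0 : ℕ) : ℤ) * max |P.lo| |P.hi|
      some (bc, R)
  | _, _ => none

/-- Well-formed box: `D > 0`, `lo_i ≤ hi_i` for `i < 8`. -/
def boxOK (D : ℕ) (lo hi : List ℕ) : Bool :=
  decide (0 < D) && (List.range 8).all fun i => decide (lo.getD i 0 ≤ hi.getD i 0)

/-- **Box check**: `sup_{t ∈ box} B_F(t) ≤ p/q`. -/
def boxCheck (F : List (ℤ × List ℤ)) (top : List ℤ) (D : ℕ) (lo hi : List ℕ) (p : ℤ) (q : ℕ) : Bool :=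
  boxOK D lo hi && decide (0 < q) &&
    match boxSummary F top D lo hi with
    | some (bc, R) => decide ((bc.hi * (2 * (D : ℤ)) + R) * (q : ℤ) ≤ p * (2 * (D : ℤ)) * (SC : ℤ))
    | none => false

/-- **Point lower check** (box = a point `pt`): `p/q ≤ B_F(pt/D)`. -/
def pointLowerCheck (F : List (ℤ × List ℤ)) (top : List ℤ) (D : ℕ) (pt : List ℕ) (p : ℤ) (q : ℕ) : Bool :=
  boxOK D pt pt && decide (0 < q) &&
    match boxSummary F top D pt pt with
    | some (bc, _) => decide (p * (SC : ℤ) ≤ bc.lo * (q : ℤ))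
    | none => false

/-! ### Soundness, part 1: feature ranges and fixed-point helpers -/

/-- The box `lo_i ≤ D·t_i ≤ hi_i` (`i < 8`) of real directions. -/
def box (D : ℕ) (lo hi : List ℕ) : Set (Fin 8 → ℝ) :=
  {t | ∀ i : Fin 8, ((lo.getD i 0 : ℕ) : ℝ) ≤ t i * D ∧ t i * D ≤ ((hi.getD i 0 : ℕ) : ℝ)}

/-- The box centre `t_c = (lo + hi)/(2D)`. -/
noncomputable def centre (D : ℕ) (lo hi : List ℕ) : Fin 8 → ℝ :=
  fun i => (((lo.getD i 0 : ℕ) : ℝ) + ((hi.getD i 0 : ℕ) : ℝ)) / (2 * D)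

/-- `sum8` is the `Fin 8` sum. -/
theorem sum8_eq_sum (f : ℕ → ℤ) : sum8 f = ∑ i : Fin 8, f i := by
  simp [sum8, Fin.sum_univ_eight]

/-- Lower corner of `c·y` on `[L, H]`. -/
theorem ite_mul_le (c : ℤ) {L H y : ℝ} (hL : L ≤ y) (hH : y ≤ H) :
    ((if 0 ≤ c then c * L else c * H : ℝ)) ≤ c * y := by
  split_ifs with hc
  · exact mul_le_mul_of_nonneg_left hL (by exact_mod_cast hc)
  · exact mul_le_mul_of_nonpos_left hH (by push Not at hc; exact_mod_cast hc.le)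

/-- Upper corner of `c·y` on `[L, H]`. -/
theorem mul_le_ite (c : ℤ) {L H y : ℝ} (hL : L ≤ y) (hH : y ≤ H) :
    (c : ℝ) * y ≤ (if 0 ≤ c then c * H else c * L : ℝ) := by
  split_ifs with hc
  · exact mul_le_mul_of_nonneg_left hH (by exact_mod_cast hc)
  · exact mul_le_mul_of_nonpos_left hL (by push Not at hc; exact_mod_cast hc.le)

/-- `D·x_c(t)` as a sum. -/
theorem featVal_mul_eq (c : List ℤ) (t : Fin 8 → ℝ) (D : ℝ) :
    featVal c t * D = ∑ i : Fin 8, (coef c i : ℝ) * (t i * D) := by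
  simp [featVal, Finset.sum_mul, mul_assoc]

/-- `minNum ≤ D·x_c(t)` on the box. -/
theorem minNum_le {D : ℕ} {lo hi : List ℕ} {t : Fin 8 → ℝ} (h : t ∈ box D lo hi) (c : List ℤ) :
    (minNum c lo hi : ℝ) ≤ featVal c t * D := by
  rw [featVal_mul_eq, minNum, sum8_eq_sum]; push_cast
  exact Finset.sum_le_sum fun i _ => ite_mul_le _ (h i).1 (h i).2

/-- `D·x_c(t) ≤ maxNum` on the box. -/
theorem le_maxNum {D : ℕ} {lo hi : List ℕ} {t : Fin 8 → ℝ} (h : t ∈ box D lo hi) (c : List ℤ) :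
    featVal c t * D ≤ (maxNum c lo hi : ℝ) := by
  rw [featVal_mul_eq, maxNum, sum8_eq_sum]; push_cast
  exact Finset.sum_le_sum fun i _ => mul_le_ite _ (h i).1 (h i).2

/-- `minNum + maxNum = 2D·x_c(t_c)`. -/
theorem minNum_add_maxNum {D : ℕ} (hD : 0 < D) (lo hi : List ℕ) (c : List ℤ) :
    (minNum c lo hi : ℝ) + maxNum c lo hi = featVal c (centre D lo hi) * (2 * D) := by
  rw [featVal_mul_eq, minNum, maxNum, sum8_eq_sum, sum8_eq_sum]; push_cast
  rw [← Finset.sum_add_distrib]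
  refine Finset.sum_congr rfl fun i _ => ?_
  have hD' : (2 * D : ℝ) ≠ 0 := by positivity
  simp only [centre, div_mul_cancel₀ _ hD']
  split_ifs <;> ring

/-- The centre lies in the box. -/
theorem centre_mem {D : ℕ} (hD : 0 < D) {lo hi : List ℕ} (hle : ∀ i : Fin 8, lo.getD i 0 ≤ hi.getD i 0) :
    centre D lo hi ∈ box D lo hi := by
  intro i
  have hD' : (0 : ℝ) < D := by exact_mod_cast hD
  have h' : ((lo.getD i 0 : ℕ) : ℝ) ≤ ((hi.getD i 0 : ℕ) : ℝ) := by exact_mod_cast hle i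
  have e : centre D lo hi i * D = (((lo.getD i 0 : ℕ) : ℝ) + ((hi.getD i 0 : ℕ) : ℝ)) / 2 := by
    simp only [centre]; field_simp
  rw [e]
  constructor <;> linarith

/-- Segments between box points stay in the box. -/
theorem segment_mem {D : ℕ} {lo hi : List ℕ} {u v : Fin 8 → ℝ} (hu : u ∈ box D lo hi) (hv : v ∈ box D lo hi)
    {θ : ℝ} (hθ : θ ∈ Icc (0 : ℝ) 1) : u + θ • (v - u) ∈ box D lo hi := by
  intro i
  have h1 := hu i; have h2 := hv i
  simp only [Pi.add_apply, Pi.smul_apply, Pi.sub_apply, smul_eq_mul]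
  rw [show (u i + θ * (v i - u i)) * D = (1 - θ) * (u i * D) + θ * (v i * D) by ring]
  obtain ⟨h0, h1'⟩ := hθ
  constructor <;> nlinarith [h1.1, h1.2, h2.1, h2.2]

/-- Distance to the centre: `|t_i − t_c,i| ≤ (hi_i − lo_i)/(2D)`. -/
theorem abs_sub_centre_le {D : ℕ} (hD : 0 < D) {lo hi : List ℕ} {t : Fin 8 → ℝ} (h : t ∈ box D lo hi)
    (i : Fin 8) : |t i - centre D lo hi i| ≤ (((hi.getD i 0 : ℕ) : ℝ) - ((lo.getD i 0 : ℕ) : ℝ)) / (2 * D) := by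
  have hD' : (0 : ℝ) < D := by exact_mod_cast hD
  have e : t i - centre D lo hi i =
      (2 * (t i * D) - (((lo.getD i 0 : ℕ) : ℝ) + ((hi.getD i 0 : ℕ) : ℝ))) / (2 * D) := by
    simp only [centre]; field_simp
  rw [e, abs_div, abs_of_pos (by positivity : (0 : ℝ) < 2 * D)]
  refine div_le_div_of_nonneg_right ?_ (by positivity)
  have := h i
  exact abs_le.mpr ⟨by linarith [this.2], by linarith [this.1]⟩

/-- The scale is positive. -/
theorem SC_pos : 0 < SC := by unfold SC; positivity

/-- A membership gives an absolute bound by the endpoint magnitudes. -/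
theorem abs_le_of_mem {x : ℝ} {I : MI} (h : MI.mem SC x I) : |x| ≤ ((max |I.lo| |I.hi| : ℤ) : ℝ) / (SC : ℝ) := by
  have hS : (0 : ℝ) < SC := by exact_mod_cast SC_pos
  rw [le_div_iff₀ hS]; push_cast
  rw [← abs_of_pos hS, ← abs_mul]
  obtain ⟨h1, h2⟩ := h
  exact abs_le_max_abs_abs h1 h2

/-- `Int.toNat` of a positive integer, as a real number. -/
theorem cast_toNat_of_pos {A : ℤ} (hA : 0 < A) : ((A.toNat : ℕ) : ℝ) = (A : ℝ) := by
  have : (A.toNat : ℤ) = A := Int.toNat_of_nonneg hA.le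
  exact_mod_cast this

/-- `log x` on `[A/D, B/D]` from enclosures of `log A`, `log B`, `log D`. -/
theorem mem_log_of_range {A B : ℤ} {D : ℕ} (hD : 0 < D) (hA : 0 < A) {LA LB LD : MI}
    (hLA : MI.mem SC (Real.log (A.toNat : ℕ)) LA) (hLB : MI.mem SC (Real.log (B.toNat : ℕ)) LB)
    (hLD : MI.mem SC (Real.log D) LD) {x : ℝ} (h1 : (A : ℝ) ≤ x * D) (h2 : x * D ≤ (B : ℝ)) :
    MI.mem SC (Real.log x) ((⟨LA.lo, LB.hi⟩ : MI).sub LD) := by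
  have hD' : (0 : ℝ) < D := by exact_mod_cast hD
  have hA' : (0 : ℝ) < A := by exact_mod_cast hA
  have hxD : 0 < x * D := hA'.trans_le h1
  have hx : 0 < x := (mul_pos_iff_of_pos_right hD').mp hxD
  have hB : 0 < B := by exact_mod_cast (hxD.trans_le h2 : (0 : ℝ) < B)
  rw [cast_toNat_of_pos hA] at hLA; rw [cast_toNat_of_pos hB] at hLB
  have e : Real.log x = Real.log (x * D) - Real.log D := by
    rw [Real.log_mul hx.ne' hD'.ne']; ring
  rw [e]
  refine MI.mem_sub ⟨?_, ?_⟩ hLD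
  · exact hLA.1.trans (mul_le_mul_of_nonneg_right (Real.log_le_log hA' h1) (Nat.cast_nonneg _))
  · exact (mul_le_mul_of_nonneg_right (Real.log_le_log hxD h2) (Nat.cast_nonneg _)).trans hLB.2

/-- The centre term: `ε·x_c·log x_c` with `x_c = X/(2D)` from `log X`, `log 2D`. -/
theorem mem_centre_term {X ε : ℤ} {D : ℕ} (hD : 0 < D) (hX : 0 < X) {LX L2D : MI}
    (hLX : MI.mem SC (Real.log (X.toNat : ℕ)) LX) (hL2D : MI.mem SC (Real.log ((2 * D : ℕ) : ℝ)) L2D)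
    {x : ℝ} (hx : x * (2 * D) = X) :
    MI.mem SC ((ε : ℝ) * (x * Real.log x)) (((LX.sub L2D).mulInt (ε * X)).divNat (2 * D)) := by
  have hD' : (0 : ℝ) < 2 * D := by positivity
  have hX' : (0 : ℝ) < X := by exact_mod_cast hX
  rw [cast_toNat_of_pos hX] at hLX
  have hx' : x = X / (2 * D) := by rw [← hx, mul_div_cancel_right₀ _ hD'.ne']
  have hlog : Real.log x = Real.log X - Real.log ((2 * D : ℕ) : ℝ) := by
    rw [hx', Real.log_div hX'.ne' hD'.ne']; norm_cast
  have h := MI.mem_divNat (MI.mem_mulInt (MI.mem_sub hLX hL2D) (ε * X)) (n := 2 * D) (by omega)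
  convert h using 1
  rw [hlog, hx']; push_cast; field_simp

end LemmaFBox

end Summit.KontsevichZagierPeriods.Zeta5Search.Barrier.ConeGamma
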